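import Summits.Ventures.HSemireg.WedgeHankelCoSiegel

/-!
# Venture HSemireg — THE IMAGE OF A NODE, NAMED: `V(univ, w_n(q), k′) = coSiegel(n + k′) ⊓ xRich(n + k′, n − P − 1)` for a class of exact order `P` at the node `0`
# — the co-Siegel forms with AT LEAST `n − P` x-letters; at the node `λ`, at least `n − P` letters from the frame `{x_a + λ y_a}`

HONEST FRAMING. Part of the Lean index of the computation cell `pub-hsemireg` (seat p10 gen 16, Sunday typer «UNIFORM-IN-n»).
Finite-dimensional EXTERIOR ALGEBRA over a field ONLY: no variety, no cohomology theory, no sheaf, no Ext group, no semiregularity map;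
nothing here says that HC / HC_CM / HC_AV holds; no Literature fact is declared or used.  Custodian versions as in `WedgeHankelSiegelIdeal` (1/3) and
`WedgeKernelDuality`; the dictionary (`plane(a,b) ↔ H^b(⋀^a T)`; images of `⌟v`) is QUOTED, never asserted.

WHAT IS IN THE TREE / KEYED.  F4 `WedgeHankelCoSiegel`: `V(univ, w_n(q), k′) = coSiegel(n+k′) ⊓ Ann_{n+k′}(xRich(k, P))` for exact order `P ≤ k′`; E2 (the projections `prj`, the
grading, `coord_eq_zero_of_mem_plane`), (10) `mul_mem_plane`, E3 (`xRich`, `plane_le_xRich`), E1 (non-degeneracy on monomials).  THIS FILE computes the annihilator of `xRich`: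
* §68 the top coefficient vanishes off the top block (`topCoeff_eq_zero_of_mem_plane`); **`Ann_xRich`: `Ann_j(xRich(k, P)) = xRich(j, n − P − 1)` for `k + j = 2n`, `P < n`**
  — a degree-`j` form pairs to zero with every degree-`k` form having more than `P` x-letters iff all its monomials have at least `n − P` x-letters (⊇ by letter count;
  ⊆ by E1's non-degeneracy applied to each projection `prj_{c, j−c} θ`, `c < n − P`).
* §69 **THE IMAGE OF A NODE, NAMED: `V_w_of_order_eq`: `V(univ, w_n(q), k′) = coSiegel(n + k′) ⊓ xRich(n + k′, n − P − 1)`** for `q` of exact order `P` at `0`, `P ≤ k′`,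
  `P < n`, `k + k′ = n`; **`V_w_expMul_of_order_eq`**: at the node `λ`, `coSiegel(n+k′) ⊓ Φs λ (xRich(n+k′, n−P−1))`; the pure class (`P = 0`):
  `coSiegel(n+k′) ⊓ plane(n, k′)`-type statement `V_w_pure_eq` — since `x_{[n]} ∧ ⋀^{k′} = plane(n, k′)` lies in the co-Siegel space, the image IS `xRich(n+k′, n−1)`.
NOT typed here: images of divisor classes by name (F2d gives them as direct sums of these); the node at `∞` (swap: `yRich`).  Class side only.
Namespace `Summit.Ventures.HSemireg.Wedge.KernelDuality` (continued); new names only.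
-/

open Module

namespace Summit.Ventures.HSemireg.Wedge.KernelDuality

open Summit.Ventures.HSemireg.Wedge Summit.Ventures.HSemireg.Wedge.Kunneth Summit.Ventures.HSemireg.Wedge.Hankel
  Summit.Ventures.HSemireg.Wedge.HankelSiegel Summit.Ventures.HSemireg.Wedge.HankelSiegelIdeal Summit.Ventures.HSemireg.Wedge.KunnethKernel
  Summit.Ventures.HSemireg.Wedge.HankelSecant Summit.Ventures.HSemireg.Wedge.HankelFrameChange

variable (K : Type*) [Field K] {n : ℕ}

/-! ## §68. The annihilator of `xRich` -/

/-- the full support has `n` x-letters … -/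
lemma card_Pof_univ : (Pof (Finset.univ : Finset (In n))).card = n := by
  rw [Pof, Finset.filter_true_of_mem (fun a _ => Finset.mem_univ _), Finset.card_univ, Fintype.card_fin]

/-- … and `n` y-letters. -/
lemma card_Qof_univ : (Qof (Finset.univ : Finset (In n))).card = n := by
  rw [Qof, Finset.filter_true_of_mem (fun a _ => Finset.mem_univ _), Finset.card_univ, Fintype.card_fin]

/-- **THE TOP COEFFICIENT VANISHES OFF THE TOP BLOCK**: `τ(z) = 0` for `z ∈ plane(a, b)` with `(a, b) ≠ (n, n)`. -/
theorem topCoeff_eq_zero_of_mem_plane {a b : ℕ} (h : a ≠ n ∨ b ≠ n) {z : HT K (In n)} (hz : z ∈ plane K n a b) : topCoeff K z = 0 := by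
  rw [topCoeff_apply]
  refine coord_eq_zero_of_mem_plane K hz ?_
  rw [card_Pof_univ, card_Qof_univ]
  rcases h with h | h
  · exact Or.inl (Ne.symm h)
  · exact Or.inr (Ne.symm h)

/-- `plane(a, b) ≤ Hom(univ, a + b)`. -/
lemma plane_le_Hom (a b : ℕ) : plane K n a b ≤ Hom K (In n) Finset.univ (a + b) := by
  rw [Hom_univ_eq_exteriorPower]; exact plane_le_exteriorPower K a b

/-- **LETTER COUNT**: a form with at least `n − P` x-letters pairs to zero with every form having more than `P` x-letters:
`xRich(j, n − P − 1) ≤ Ann_j(xRich(k, P))` (`P < n`). -/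
theorem xRich_le_Ann_xRich {k j P : ℕ} (hP : P < n) : xRich K n j (n - P - 1) ≤ Ann K j (xRich K n k P) := by
  refine iSup₂_le fun c hc => ?_
  rw [Finset.mem_Ioc] at hc
  intro θ hθ
  refine mem_Ann.mpr ⟨?_, fun v hv => ?_⟩
  · have := plane_le_Hom K c (j - c) hθ
    rwa [show c + (j - c) = j by omega] at this
  · -- v ↦ τ(θ v) vanishes on every block of xRich(k, P)
    have key : xRich K n k P ≤ LinearMap.ker (topCoeff K ∘ₗ LinearMap.mulLeft K θ) := by
      refine iSup₂_le fun a ha => ?_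
      rw [Finset.mem_Ioc] at ha
      intro u hu
      rw [LinearMap.mem_ker, LinearMap.comp_apply, LinearMap.mulLeft_apply]
      exact topCoeff_eq_zero_of_mem_plane K (Or.inl (by omega)) (mul_mem_plane K hθ hu)
    have := key hv
    rwa [LinearMap.mem_ker, LinearMap.comp_apply, LinearMap.mulLeft_apply] at this

/-- the top coefficient of `θ ∧ E_U` for `θ ∈ ⋀^j` sees only the projection of `θ` onto the block complementary to the type of `U`. -/
lemma topCoeff_mul_B_eq_topCoeff_prj_mul_B {j : ℕ} {θ : HT K (In n)} (hθ : θ ∈ ⋀[K]^j (In n → K)) (U : Finset (In n)) {c : ℕ}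
    (hc : c + (Pof U).card = n) (hcj : c ≤ j) :
    topCoeff K (θ * B K (In n) U) = topCoeff K (prj K n c (j - c) θ * B K (In n) U) := by
  conv_lhs => rw [← sum_prj K hθ]
  rw [Finset.sum_mul, map_sum, Finset.sum_eq_single c]
  · intro c' hc' hne
    exact topCoeff_eq_zero_of_mem_plane K (Or.inl (by omega)) (mul_mem_plane K (prj_mem_plane K c' (j - c') θ) (B_mem_plane K rfl rfl))
  · intro h; exact absurd (Finset.mem_range.mpr (by omega)) h

/-- **THE ANNIHILATOR OF `xRich`: `Ann_j(xRich(k, P)) = xRich(j, n − P − 1)`** for `k + j = 2n` and `P < n` — a degree-`j` form pairs to zero with every degree-`k` form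
having more than `P` x-letters iff each of its monomials has at least `n − P` x-letters. -/
theorem Ann_xRich {k j P : ℕ} (hkj : k + j = n + n) (hP : P < n) : Ann K j (xRich K n k P) = xRich K n j (n - P - 1) := by
  refine le_antisymm ?_ (xRich_le_Ann_xRich K hP)
  intro θ hθ
  obtain ⟨hθj, h0⟩ := mem_Ann.mp hθ
  rw [Hom_univ_eq_exteriorPower] at hθj
  rw [← sum_prj K hθj]
  refine Submodule.sum_mem _ fun c hc => ?_
  rw [Finset.mem_range] at hc
  by_cases hcP : n - P ≤ c
  · exact plane_le_xRich K (by omega) (by omega) (prj_mem_plane K c (j - c) θ)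
  · -- the projection onto a block with fewer than n − P x-letters vanishes, by non-degeneracy against the monomials of xRich(k, P)
    have hz : prj K n c (j - c) θ = 0 := by
      refine eq_zero_of_forall_top_mul_B K (a := j) (b := k) (by rw [Fintype.card_fin]; omega)
        (by have := plane_le_Hom K c (j - c) (prj_mem_plane K c (j - c) θ); rwa [show c + (j - c) = j by omega] at this) fun U hU => ?_
      by_cases hcU : c + (Pof U).card = n
      · -- then E_U has more than P x-letters: it lies in xRich(k, P), and τ(θ ∧ E_U) = τ(prj θ ∧ E_U)
        have hPQ := card_Pof_add_card_Qof U
        have hUx : B K (In n) U ∈ xRich K n k P := by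
          have h1 : B K (In n) U ∈ plane K n (Pof U).card (k - (Pof U).card) := B_mem_plane K rfl (by omega)
          exact plane_le_xRich K (by omega) (by omega) h1
        rw [← topCoeff_mul_B_eq_topCoeff_prj_mul_B K hθj U hcU (by omega)]
        exact h0 _ hUx
      · exact topCoeff_eq_zero_of_mem_plane K (Or.inl hcU) (mul_mem_plane K (prj_mem_plane K c (j - c) θ) (B_mem_plane K rfl rfl))
    rw [hz]; exact Submodule.zero_mem _

/-! ## §69. The image of a node, named -/

/-- **THE IMAGE OF A NODE AT `0`, NAMED: `V(univ, w_n(q), k′) = coSiegel(k′ + n) ⊓ xRich(k′ + n, n − P − 1)`** for `q` supported on `[0, P]` with `q_P ≠ 0`, `P ≤ k′`,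
`P < n`, `k + k′ = n` — the image of `θ ↦ θ ∧ w_n(q)` on `⋀^{k′}` is EXACTLY the co-Siegel forms of degree `n + k′` all of whose monomials have at least `n − P` x-letters. -/
theorem V_w_of_order_eq {k k' P : ℕ} (hkk' : k + k' = n) (hP : P ≤ k') (hPn : P < n) {q : ℕ → K} (hq : ∀ j, P < j → q j = 0) (hqP : q P ≠ 0) :
    V K (In n) Finset.univ (w K n n q) k' = coSiegel K n (k' + n) ⊓ xRich K n (k' + n) (n - P - 1) := by
  rw [V_w_of_order K hkk' hP hq hqP, Ann_xRich K (by omega) hPn]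

/-- **… AT THE NODE `λ`: `V(univ, w_n(expMul λ q), k′) = coSiegel(k′ + n) ⊓ Φs λ (xRich(k′ + n, n − P − 1))`** — the co-Siegel forms with at least `n − P` letters from the
frame `{x_a + λ y_a}`. -/
theorem V_w_expMul_of_order_eq (lam : K) {k k' P : ℕ} (hkk' : k + k' = n) (hP : P ≤ k') (hPn : P < n) {q : ℕ → K} (hq : ∀ j, P < j → q j = 0)
    (hqP : q P ≠ 0) :
    V K (In n) Finset.univ (w K n n (expMul K lam q)) k' = coSiegel K n (k' + n) ⊓ (xRich K n (k' + n) (n - P - 1)).map (Φs K (n := n) lam).toLinearMap := by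
  rw [V_w_expMul_of_order' K lam hkk' hP hq hqP, Ann_xRich K (by omega) hPn]

/-- the image depends only on `(P, k′)`: **two classes of the same exact order at `0` have the same image, and it GROWS with `P`** (`xRich(·, m)` is antitone in `m`). -/
theorem V_w_mono_of_order {k k' P P' : ℕ} (hkk' : k + k' = n) (hPP' : P ≤ P') (hP' : P' ≤ k') (hPn : P' < n) {q q' : ℕ → K}
    (hq : ∀ j, P < j → q j = 0) (hqP : q P ≠ 0) (hq' : ∀ j, P' < j → q' j = 0) (hqP' : q' P' ≠ 0) :
    V K (In n) Finset.univ (w K n n q) k' ≤ V K (In n) Finset.univ (w K n n q') k' := by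
  rw [V_w_of_order_eq K hkk' (by omega) (by omega) hq hqP, V_w_of_order_eq K hkk' hP' hPn hq' hqP']
  refine inf_le_inf_left _ (iSup₂_le fun c hc => ?_)
  rw [Finset.mem_Ioc] at hc
  exact plane_le_xRich K (by omega) hc.2

end Summit.Ventures.HSemireg.Wedge.KernelDuality
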